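/-
Copyright: b2b-lace packet (LEAN TYPING SEAT 1 gen 35, node KU-SEP-WCLASS, a leaf under KU-SEP-WSLICE /
`SrwTwistPermSymmetry` / `SrwTwistCosPowRow`). The `l ≤ 2` weighted twisted slices of the K/U rows in
PRODUCT CLASSES: by the coordinate-permutation symmetry of the twisted moment, the `d²` (resp. `d`) product
cosine seeds of the multinomial reduction of `D̂²` (resp. `D̂`, `D̂^{sin}`) collapse to TWO (resp. one) classes,
or to four (resp. two) classes relative to a marked coordinate; plus monotonicity of the second moment in the
weight. d-generic, number-free, def-free; what-if / input-certification lane SUPPORT; nothing here is a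
certificate; no statement at any fixed dimension.
-/
import Literature.Probability.FitznerVanDerHofstad2017.SrwTwistPermSymmetry
import Literature.Probability.FitznerVanDerHofstad2017.SrwTwistDsinSlices
import HarnessLib

/-!
# Weighted twisted slices in product classes; the second moment is monotone in the weight

CITATION HEADER (PLACEMENT v2). Part of the certified REPRODUCTION of the numerical inputs of
R. Fitzner, R. van der Hofstad, *Generalized approach to the non-backtracking lace expansion*,
Probab. Theory Related Fields 169 (2017) 1041–1119 [NoBLE17-I] (arXiv:1506.07969): the SRW integrals
`K_{n,l}`, `U_{n,l}` of (3.36)–(3.38) p. 1071 (weights `D̂^l`, `D̂^l D̂^{sin}`, §3.3.3 p. 1070) and their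
evaluation §5.1 (5.2)–(5.9) pp. 1089–1092.  The tree prices them through TWISTED MOMENTS
`Tw^w_n(x;β) = ∫ w cos(β D̂^{(x)}) Ĉⁿ dk/(2π)^d` (`srwTwist`) and reduces a `D̂^l`-weighted moment to PRODUCT
cosine-power moments (`srwTwist_Dhat_pow_eq_sum_srwTwist_prodCosPow`: `d^l` terms indexed by maps
`p : Fin l → Fin d`; `srwTwist_Dhat_pow_mul_Dsin_eq_sum_srwTwist_prodCosPow`: `d^{l+1}` terms).  Nothing in
this file is a claim of the paper beyond those formulas; everything is PROVED.

## What this module adds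

The coordinate-permutation symmetry `Tw^{w∘(·∘σ)}_n(x;β) = Tw^w_n(x;β)` (`srwTwist_weight_comp_perm`, valid at
EVERY node `x` because `D̂^{(x)}` is already symmetrised) makes those `d^l` seeds constant on classes.  For the
weights of Schwinger–weight order `l ≤ 2` the classes are written out, for a general bounded measurable
co-factor `u` that is permutation invariant (or invariant under the permutations fixing a marked coordinate
`i₀`):

* transports `srwTwist_transport₁/₂` (marked) and `srwTwist_transport₁'/₂'` (full): `Tw^{u·g(k_j)}_n = Tw^{u·g(k_i)}_n`,
  `Tw^{u·g(k_j)g'(k_{j'})}_n = Tw^{u·g(k_i)g'(k_{i'})}_n`;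
* `srwTwist_mul_Dhat_eq_class` / `_marked`: `Tw^{u D̂}_n = Tw^{u cos k_i}_n`, resp.
  `= d⁻¹(Tw^{u cos k_{i₀}}_n + (d−1) Tw^{u cos k_i}_n)`;
* `srwTwist_mul_Dhat_sq_eq_classes` / `_marked`: **`Tw^{u D̂²}_n = d⁻¹ Tw^{u cos² k_i}_n + ((d−1)/d) Tw^{u cos k_i cos k_{i'}}_n`**,
  resp. the four classes `cos² k_{i₀} ‖ cos² k_i ‖ cos k_{i₀} cos k_i ‖ cos k_i cos k_{i'}` with multiplicities
  `1, d−1, 2(d−1), (d−1)(d−2)` (all over `d²`);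
* `srwTwist_mul_Dsin_eq_class` / `_marked`: `Tw^{u D̂^{sin}}_n = d⁻¹ Tw^{u sin² k_i}_n`, resp.
  `= d⁻²(Tw^{u sin² k_{i₀}}_n + (d−1) Tw^{u sin² k_i}_n)`; `srwTwist_mul_sin_sq_eq_sub`: `sin² = 1 − cos²` inside `Tw`;
* the unit co-factor: `srwTwist_abs_Dhat_sq_eq_classes` (the `K_{n,2}` weight `|D̂|²`: TWO product seeds per
  abscissa instead of `d²`), `srwTwist_abs_Dhat_pow_zero_mul_Dsin_eq` (the `U_{n,0}` weight:
  `Tw^{D̂^{sin}}_n = d⁻¹(Tw^{1}_n − Tw^{cos² k_i}_n)`), `srwTwist_abs_Dhat_sq_mul_Dsin_eq_marked` (the `U_{n,2}` weight in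
  four `sin² k_{i₀}`-marked classes);
* the `KM₂` weight (`l = 0`): `Dsin_comp_perm`, `srwTwist_Dhat_mul_Dsin_eq_classes` (`Tw^{D̂ D̂^{sin}}_n` in the
  two classes `cos k_i sin² k_i ‖ cos k_i sin² k_{i'}`), `srwTwist_Dsin_sq_eq_classes` (`sin⁴ k_i ‖ sin² k_i sin² k_{i'}`),
  **`srwTwist_abs_Dhat_pow_zero_mul_Mhat_sq_eq_classes`** (`Tw^{|D̂|⁰ M̂²}_n` = six class seeds at Schwinger orders
  `n, n+1, n+2`, via `srwTwist_abs_Dhat_pow_mul_Mhat_sq_eq_of_even`), and the pure-product readings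
  `srwTwist_cos_mul_sin_sq_eq_sub`, `srwTwist_sin_sq_mul_sin_sq_eq`, `srwTwist_sin_pow_four_eq`;
* bridges from the exponent-vector form of the product kernels: `prod_cos_pow_single`,
  `prod_cos_pow_single_add_single`, `srwTwist_prodCosPow_single`, `srwTwist_prodCosPow_single_add_single`;
* the second moment is monotone and linear in the weight: `srwSqMom_mono_weight`, `srwSqMom_const_mul_weight`,
  and `srwSqMom_abs_Dhat_pow_mul_Dsin_le`: `Sq^{|D̂|^l D̂^{sin}}_n(x) ≤ d⁻¹ Sq^{|D̂|^l}_n(x)` (the `U`-row second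
  moment from the `K`-row one, `D̂^{sin} ≤ 1/d`).

Everything is PROVED (standard axioms), generic in the dimension `d`, number-free and def-free.  No instance,
no table, no named fact.  Epistemic status / lane: what-if / input-certification SUPPORT; nothing here is a
certificate; no statement at a specific dimension.

## References
* R. Fitzner, R. van der Hofstad, *Generalized approach to the non-backtracking lace expansion*,
  PTRF 169 (2017) 1041–1119 (arXiv:1506.07969), §3.3.3 p. 1070, (3.34)–(3.38) p. 1071, §5.1 (5.2)–(5.9)
  pp. 1089–1092. [FitznerVanDerHofstad2016NoBLE]
[cite: FitznerVanDerHofstad2016NoBLE, §3.3.3 p. 1070, (3.34)–(3.38) p. 1071, (5.2)–(5.9) pp. 1089–1092]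
-/

noncomputable section

open MeasureTheory Real Finset
open scoped BigOperators

namespace Literature.Probability.FitznerVanDerHofstad2017

open Literature.Barriers.CriticalPhenomena
open Literature.Barriers.CriticalPhenomena.Slade2006Prop53 (P)

variable {d : ℕ}

/-! ### The second moment is monotone and linear in the weight -/

/-- **`Sq^{w₁}_n(x) ≤ Sq^{w₂}_n(x)` for bounded measurable weights `w₁ ≤ w₂`** (`d ≥ 2n+1`; the density
`(D̂^{(x)})² Ĉⁿ` is nonnegative). [cite: FitznerVanDerHofstad2016NoBLE, (3.34) p. 1071; (5.7) p. 1091] -/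
theorem srwSqMom_mono_weight {n : ℕ} (hd : 2 * n + 1 ≤ d) {w₁ w₂ : (Fin d → ℝ) → ℝ}
    (h₁ : Measurable w₁) (h₂ : Measurable w₂) {W₁ W₂ : ℝ} (hb₁ : ∀ k, |w₁ k| ≤ W₁)
    (hb₂ : ∀ k, |w₂ k| ≤ W₂) (hle : ∀ k, w₁ k ≤ w₂ k) (x : Fin d → ℤ) :
    srwSqMom d n w₁ x ≤ srwSqMom d n w₂ x := by
  unfold srwSqMom
  refine div_le_div_of_nonneg_right (integral_mono (integrable_weight_sq_mul_Chat_pow hd h₁ hb₁ x)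
    (integrable_weight_sq_mul_Chat_pow hd h₂ hb₂ x) fun k => ?_) (by positivity)
  exact mul_le_mul_of_nonneg_right (mul_le_mul_of_nonneg_right (hle k) (sq_nonneg _))
    (pow_nonneg (Chat_one_nonneg k) _)

/-- `Sq^{c·w}_n(x) = c · Sq^{w}_n(x)`. [cite: FitznerVanDerHofstad2016NoBLE, (3.34) p. 1071; (5.7) p. 1091] -/
theorem srwSqMom_const_mul_weight {n : ℕ} (c : ℝ) (w : (Fin d → ℝ) → ℝ) (x : Fin d → ℤ) :
    srwSqMom d n (fun k => c * w k) x = c * srwSqMom d n w x := by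
  simp only [srwSqMom]
  rw [mul_div_assoc', ← integral_const_mul]
  congr 1
  refine integral_congr_ae (ae_of_all _ fun k => ?_)
  ring

/-- **The `U`-row second moment from the `K`-row one:** `Sq^{|D̂|^l D̂^{sin}}_n(x) ≤ d⁻¹ · Sq^{|D̂|^l}_n(x)`
(`0 ≤ D̂^{sin} ≤ 1/d`, `d ≥ 2n+1`). [cite: FitznerVanDerHofstad2016NoBLE, §3.3.3 p. 1070, (3.38) p. 1071; (5.7), (5.9) pp. 1091–1092] -/
theorem srwSqMom_abs_Dhat_pow_mul_Dsin_le {n : ℕ} (hd : 2 * n + 1 ≤ d) (l : ℕ) (x : Fin d → ℤ) :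
    srwSqMom d n (fun k => |Dhat d k| ^ l * Dsin d k) x
      ≤ 1 / d * srwSqMom d n (fun k => |Dhat d k| ^ l) x := by
  have hd1 : 1 ≤ d := by omega
  have hm : Measurable fun k : Fin d → ℝ => |Dhat d k| ^ l := (continuous_Dhat d).measurable.abs.pow_const l
  have hms : Measurable (Dsin d) := by unfold Dsin; fun_prop
  rw [← srwSqMom_const_mul_weight]
  refine srwSqMom_mono_weight hd (w₁ := fun k => |Dhat d k| ^ l * Dsin d k)
    (w₂ := fun k => 1 / (d : ℝ) * |Dhat d k| ^ l) (hm.mul hms) (measurable_const.mul hm)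
    (W₁ := 1 / d) (W₂ := 1 / d * 1) (fun k => ?_) (fun k => ?_) (fun k => ?_) x
  · rw [abs_mul, abs_of_nonneg (Dsin_nonneg k), abs_of_nonneg (pow_nonneg (abs_nonneg _) _)]
    exact (mul_le_mul (abs_Dhat_pow_le_one l k) (Dsin_le_inv hd1 k) (Dsin_nonneg k) zero_le_one).trans
      (by rw [one_mul])
  · rw [abs_mul, abs_of_nonneg (by positivity : (0 : ℝ) ≤ 1 / d),
      abs_of_nonneg (pow_nonneg (abs_nonneg (Dhat d k)) l)]
    exact mul_le_mul_of_nonneg_left (abs_Dhat_pow_le_one l k) (by positivity)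
  · rw [mul_comm]
    exact mul_le_mul_of_nonneg_right (Dsin_le_inv hd1 k) (pow_nonneg (abs_nonneg _) _)

/-! ### Transports: coordinate permutations of a coordinate factor of the weight -/

/-- **One moving coordinate, marked point fixed.** If `u` is invariant under the coordinate permutations fixing
`i₀` and `i, j ≠ i₀`, then `Tw^{u·g(k_j)}_n(x;β) = Tw^{u·g(k_i)}_n(x;β)`.
[cite: FitznerVanDerHofstad2016NoBLE, (3.34)–(3.36) p. 1071] -/
theorem srwTwist_transport₁ {n : ℕ} (u : (Fin d → ℝ) → ℝ) (g : ℝ → ℝ) {i₀ i j : Fin d}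
    (hu : ∀ σ : Equiv.Perm (Fin d), σ i₀ = i₀ → ∀ k : Fin d → ℝ, u (k ∘ σ) = u k)
    (hi : i ≠ i₀) (hj : j ≠ i₀) (x : Fin d → ℤ) (β : ℝ) :
    srwTwist d n (fun k => u k * g (k j)) x β = srwTwist d n (fun k => u k * g (k i)) x β := by
  have hσ : Equiv.swap i j i₀ = i₀ := Equiv.swap_apply_of_ne_of_ne hi.symm hj.symm
  have h := srwTwist_weight_comp_perm (n := n) (Equiv.swap i j) (fun k => u k * g (k i)) x β
  simpa only [Function.comp_apply, Equiv.swap_apply_left, hu _ hσ] using h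

/-- **One moving coordinate, `u` permutation invariant:** `Tw^{u·g(k_j)}_n(x;β) = Tw^{u·g(k_i)}_n(x;β)`.
[cite: FitznerVanDerHofstad2016NoBLE, (3.34)–(3.36) p. 1071] -/
theorem srwTwist_transport₁' {n : ℕ} (u : (Fin d → ℝ) → ℝ) (g : ℝ → ℝ)
    (hu : ∀ (σ : Equiv.Perm (Fin d)) (k : Fin d → ℝ), u (k ∘ σ) = u k) (i j : Fin d)
    (x : Fin d → ℤ) (β : ℝ) :
    srwTwist d n (fun k => u k * g (k j)) x β = srwTwist d n (fun k => u k * g (k i)) x β := by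
  have h := srwTwist_weight_comp_perm (n := n) (Equiv.swap i j) (fun k => u k * g (k i)) x β
  simpa only [Function.comp_apply, Equiv.swap_apply_left, hu] using h

/-- A coordinate permutation moving `i ↦ j`, `i' ↦ j'` and fixing `i₀` (all five constraints as stated).
[folklore] -/
private theorem exists_perm_apply₂ {i₀ i i' j j' : Fin d} (hii' : i ≠ i') (hjj' : j ≠ j')
    (hi : i ≠ i₀) (hi' : i' ≠ i₀) (hj : j ≠ i₀) (hj' : j' ≠ i₀) :
    ∃ σ : Equiv.Perm (Fin d), σ i = j ∧ σ i' = j' ∧ σ i₀ = i₀ := by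
  have hc : Equiv.swap i j i' ≠ j := fun h =>
    hii' ((Equiv.injective (Equiv.swap i j)) ((Equiv.swap_apply_left i j).trans h.symm))
  have hc₀ : Equiv.swap i j i' ≠ i₀ := fun h =>
    hi' ((Equiv.injective (Equiv.swap i j))
      (h.trans (Equiv.swap_apply_of_ne_of_ne hi.symm hj.symm).symm))
  refine ⟨(Equiv.swap i j).trans (Equiv.swap (Equiv.swap i j i') j'), ?_, ?_, ?_⟩
  · rw [Equiv.trans_apply, Equiv.swap_apply_left, Equiv.swap_apply_of_ne_of_ne hc.symm hjj']
  · rw [Equiv.trans_apply, Equiv.swap_apply_left]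
  · rw [Equiv.trans_apply, Equiv.swap_apply_of_ne_of_ne hi.symm hj.symm,
      Equiv.swap_apply_of_ne_of_ne hc₀.symm hj'.symm]

/-- A coordinate permutation moving `i ↦ j`, `i' ↦ j'` (`i ≠ i'`, `j ≠ j'`). [folklore] -/
private theorem exists_perm_apply₂' {i i' j j' : Fin d} (hii' : i ≠ i') (hjj' : j ≠ j') :
    ∃ σ : Equiv.Perm (Fin d), σ i = j ∧ σ i' = j' := by
  have hc : Equiv.swap i j i' ≠ j := fun h =>
    hii' ((Equiv.injective (Equiv.swap i j)) ((Equiv.swap_apply_left i j).trans h.symm))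
  refine ⟨(Equiv.swap i j).trans (Equiv.swap (Equiv.swap i j i') j'), ?_, ?_⟩
  · rw [Equiv.trans_apply, Equiv.swap_apply_left, Equiv.swap_apply_of_ne_of_ne hc.symm hjj']
  · rw [Equiv.trans_apply, Equiv.swap_apply_left]

/-- **Two moving coordinates, marked point fixed:** for `u` invariant under the permutations fixing `i₀`,
`i ≠ i'`, `j ≠ j'`, all four `≠ i₀`: `Tw^{u·g(k_j)g'(k_{j'})}_n(x;β) = Tw^{u·g(k_i)g'(k_{i'})}_n(x;β)`.
[cite: FitznerVanDerHofstad2016NoBLE, (3.34)–(3.36) p. 1071] -/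
theorem srwTwist_transport₂ {n : ℕ} (u : (Fin d → ℝ) → ℝ) (g g' : ℝ → ℝ) {i₀ i i' j j' : Fin d}
    (hu : ∀ σ : Equiv.Perm (Fin d), σ i₀ = i₀ → ∀ k : Fin d → ℝ, u (k ∘ σ) = u k)
    (hii' : i ≠ i') (hjj' : j ≠ j') (hi : i ≠ i₀) (hi' : i' ≠ i₀) (hj : j ≠ i₀) (hj' : j' ≠ i₀)
    (x : Fin d → ℤ) (β : ℝ) :
    srwTwist d n (fun k => u k * (g (k j) * g' (k j'))) x β
      = srwTwist d n (fun k => u k * (g (k i) * g' (k i'))) x β := by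
  obtain ⟨σ, hσi, hσi', hσ₀⟩ := exists_perm_apply₂ hii' hjj' hi hi' hj hj'
  have h := srwTwist_weight_comp_perm (n := n) σ (fun k => u k * (g (k i) * g' (k i'))) x β
  simpa only [Function.comp_apply, hσi, hσi', hu _ hσ₀] using h

/-- **Two moving coordinates, `u` permutation invariant:** `Tw^{u·g(k_j)g'(k_{j'})}_n = Tw^{u·g(k_i)g'(k_{i'})}_n`
(`i ≠ i'`, `j ≠ j'`). [cite: FitznerVanDerHofstad2016NoBLE, (3.34)–(3.36) p. 1071] -/
theorem srwTwist_transport₂' {n : ℕ} (u : (Fin d → ℝ) → ℝ) (g g' : ℝ → ℝ)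
    (hu : ∀ (σ : Equiv.Perm (Fin d)) (k : Fin d → ℝ), u (k ∘ σ) = u k) {i i' j j' : Fin d}
    (hii' : i ≠ i') (hjj' : j ≠ j') (x : Fin d → ℤ) (β : ℝ) :
    srwTwist d n (fun k => u k * (g (k j) * g' (k j'))) x β
      = srwTwist d n (fun k => u k * (g (k i) * g' (k i'))) x β := by
  obtain ⟨σ, hσi, hσi'⟩ := exists_perm_apply₂' hii' hjj'
  have h := srwTwist_weight_comp_perm (n := n) σ (fun k => u k * (g (k i) * g' (k i'))) x β
  simpa only [Function.comp_apply, hσi, hσi', hu] using h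

/-! ### Regrouping finite sums that are constant on classes -/

/-- `Σ_j F j = F i₀ + (d−1)·A` when `F j = A` off the marked index. [folklore] -/
private theorem sum_marked (i₀ : Fin d) (F : Fin d → ℝ) {A : ℝ} (hA : ∀ j, j ≠ i₀ → F j = A) :
    ∑ j, F j = F i₀ + ((d : ℝ) - 1) * A := by
  have hcard : (((Finset.univ.erase i₀).card : ℕ) : ℝ) = (d : ℝ) - 1 := by
    have h := Finset.card_erase_add_one (Finset.mem_univ i₀)
    rw [Finset.card_univ, Fintype.card_fin] at h
    have h' : (((Finset.univ.erase i₀).card : ℕ) : ℝ) + 1 = d := by exact_mod_cast h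
    linarith
  rw [← Finset.add_sum_erase _ _ (Finset.mem_univ i₀),
    Finset.sum_congr rfl fun j hj => hA j (Finset.ne_of_mem_erase hj), Finset.sum_const, nsmul_eq_mul,
    hcard]

/-- `Σ_j Σ_{j'} F j j' = d·A + d(d−1)·C` when `F` is `A` on the diagonal and `C` off it. [folklore] -/
private theorem sum_sum_diag (F : Fin d → Fin d → ℝ) {A C : ℝ} (hA : ∀ j, F j j = A)
    (hC : ∀ j j', j ≠ j' → F j j' = C) :
    ∑ j, ∑ j', F j j' = (d : ℝ) * A + (d : ℝ) * ((d : ℝ) - 1) * C := by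
  have hrow : ∀ j, ∑ j', F j j' = A + ((d : ℝ) - 1) * C := fun j => by
    rw [sum_marked j (F j) (fun j' hj' => hC j j' (Ne.symm hj')), hA j]
  rw [Finset.sum_congr rfl fun j _ => hrow j, Finset.sum_const, Finset.card_univ, Fintype.card_fin,
    nsmul_eq_mul]
  ring

/-- `Σ_j Σ_{j'} F j j' = F i₀ i₀ + (d−1)·A + 2(d−1)·B + (d−1)(d−2)·C` when, off the marked index `i₀`, `F` is `A`
on the diagonal, `B` on the marked row and column, and `C` elsewhere off the diagonal. [folklore] -/
private theorem sum_sum_marked (i₀ : Fin d) (F : Fin d → Fin d → ℝ) {A B C : ℝ}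
    (hA : ∀ j, j ≠ i₀ → F j j = A) (hB : ∀ j, j ≠ i₀ → F i₀ j = B) (hB' : ∀ j, j ≠ i₀ → F j i₀ = B)
    (hC : ∀ j j', j ≠ i₀ → j' ≠ i₀ → j ≠ j' → F j j' = C) :
    ∑ j, ∑ j', F j j' = F i₀ i₀ + ((d : ℝ) - 1) * A + 2 * ((d : ℝ) - 1) * B
      + ((d : ℝ) - 1) * ((d : ℝ) - 2) * C := by
  have hrow₀ : ∑ j', F i₀ j' = F i₀ i₀ + ((d : ℝ) - 1) * B := sum_marked i₀ (F i₀) hB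
  have hrow : ∀ j, j ≠ i₀ → ∑ j', F j j' = B + A + ((d : ℝ) - 2) * C := by
    intro j hj
    have hjm : j ∈ Finset.univ.erase i₀ := Finset.mem_erase.mpr ⟨hj, Finset.mem_univ j⟩
    have hcard : ((((Finset.univ.erase i₀).erase j).card : ℕ) : ℝ) = (d : ℝ) - 2 := by
      have h1 := Finset.card_erase_add_one (Finset.mem_univ i₀)
      have h2 := Finset.card_erase_add_one hjm
      rw [Finset.card_univ, Fintype.card_fin] at h1
      have h' : ((((Finset.univ.erase i₀).erase j).card : ℕ) : ℝ) + 1 + 1 = d := by exact_mod_cast (by omega : ((Finset.univ.erase i₀).erase j).card + 1 + 1 = d)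
      linarith
    rw [← Finset.add_sum_erase _ _ (Finset.mem_univ i₀), ← Finset.add_sum_erase _ _ hjm, hB' j hj,
      hA j hj, Finset.sum_congr rfl fun j' hj' => hC j j' hj
        (Finset.ne_of_mem_erase (Finset.mem_of_mem_erase hj')) (Finset.ne_of_mem_erase hj').symm,
      Finset.sum_const, nsmul_eq_mul, hcard]
    ring
  rw [sum_marked i₀ (fun j => ∑ j', F j j') hrow, hrow₀]
  ring

/-! ### Measurability and boundedness of the class weights -/

/-- `k ↦ u k · g(k_j)` is measurable for measurable `u`, continuous `g`. [folklore] -/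
private theorem measurable_mul_coord {u : (Fin d → ℝ) → ℝ} (hum : Measurable u) {g : ℝ → ℝ}
    (hg : Continuous g) (j : Fin d) : Measurable fun k : Fin d → ℝ => u k * g (k j) :=
  hum.mul (hg.measurable.comp (measurable_pi_apply j))

/-- `|u k · g(k_j)| ≤ U` when `|u| ≤ U`, `|g| ≤ 1`. [folklore] -/
private theorem abs_mul_coord_le {u : (Fin d → ℝ) → ℝ} {U : ℝ} (hub : ∀ k, |u k| ≤ U) {g : ℝ → ℝ}
    (hg : ∀ t, |g t| ≤ 1) (j : Fin d) (k : Fin d → ℝ) : |u k * g (k j)| ≤ U := by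
  rw [abs_mul]
  exact (mul_le_of_le_one_right (abs_nonneg _) (hg _)).trans (hub k)

/-- `|cos t · cos s| ≤ 1`. [folklore] -/
private theorem abs_cos_mul_cos_le_one (t s : ℝ) : |Real.cos t * Real.cos s| ≤ 1 := by
  rw [abs_mul]; exact mul_le_one₀ (abs_cos_le_one t) (abs_nonneg _) (abs_cos_le_one s)

/-! ### The `D̂`-linear slice -/

/-- **`Tw^{u D̂}_n = Tw^{u cos k_i}_n`** for a bounded measurable permutation-invariant co-factor `u` (`d ≥ 2n+1`):
the `d` seeds `Tw^{u cos k_j}_n` of `D̂ = d⁻¹ Σ_j cos k_j` form ONE class.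
[cite: FitznerVanDerHofstad2016NoBLE, (3.34)–(3.36) p. 1071, §5.1.1 (5.2)–(5.5)] -/
theorem srwTwist_mul_Dhat_eq_class {n : ℕ} (hd : 2 * n + 1 ≤ d) (u : (Fin d → ℝ) → ℝ)
    (hum : Measurable u) {U : ℝ} (hub : ∀ k, |u k| ≤ U)
    (hu : ∀ (σ : Equiv.Perm (Fin d)) (k : Fin d → ℝ), u (k ∘ σ) = u k) (i : Fin d)
    (x : Fin d → ℤ) (β : ℝ) :
    srwTwist d n (fun k => u k * Dhat d k) x β = srwTwist d n (fun k => u k * Real.cos (k i)) x β := by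
  have hd0 : (d : ℝ) ≠ 0 := by
    have : 1 ≤ d := by omega
    positivity
  have hw : (fun k : Fin d → ℝ => u k * Dhat d k)
      = fun k => ∑ j, (1 / (d : ℝ)) * (u k * Real.cos (k j)) := by
    funext k
    rw [Dhat, Finset.sum_div, Finset.mul_sum]
    refine Finset.sum_congr rfl fun j _ => ?_
    ring
  rw [hw, srwTwist_sum_weight Finset.univ (fun _ => 1 / (d : ℝ)) (fun j k => u k * Real.cos (k j)) hd
    (fun j _ => measurable_mul_coord hum Real.continuous_cos j)
    (fun j _ => ⟨U, abs_mul_coord_le hub abs_cos_le_one j⟩) x β, ← Finset.mul_sum,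
    Finset.sum_congr rfl fun j _ => srwTwist_transport₁' (n := n) u Real.cos hu i j x β,
    Finset.sum_const, Finset.card_univ, Fintype.card_fin, nsmul_eq_mul, one_div]
  exact inv_mul_cancel_left₀ hd0 _

/-- **`Tw^{u D̂}_n` relative to a marked coordinate:** for `u` invariant under the permutations fixing `i₀` and
`i ≠ i₀`: `Tw^{u D̂}_n = d⁻¹ (Tw^{u cos k_{i₀}}_n + (d−1) Tw^{u cos k_i}_n)`.
[cite: FitznerVanDerHofstad2016NoBLE, (3.34)–(3.36) p. 1071, §5.1.1 (5.2)–(5.5)] -/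
theorem srwTwist_mul_Dhat_eq_marked {n : ℕ} (hd : 2 * n + 1 ≤ d) (u : (Fin d → ℝ) → ℝ)
    (hum : Measurable u) {U : ℝ} (hub : ∀ k, |u k| ≤ U) {i₀ i : Fin d}
    (hu : ∀ σ : Equiv.Perm (Fin d), σ i₀ = i₀ → ∀ k : Fin d → ℝ, u (k ∘ σ) = u k) (hi : i ≠ i₀)
    (x : Fin d → ℤ) (β : ℝ) :
    srwTwist d n (fun k => u k * Dhat d k) x β
      = 1 / d * (srwTwist d n (fun k => u k * Real.cos (k i₀)) x β
          + ((d : ℝ) - 1) * srwTwist d n (fun k => u k * Real.cos (k i)) x β) := by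
  have hw : (fun k : Fin d → ℝ => u k * Dhat d k)
      = fun k => ∑ j, (1 / (d : ℝ)) * (u k * Real.cos (k j)) := by
    funext k
    rw [Dhat, Finset.sum_div, Finset.mul_sum]
    refine Finset.sum_congr rfl fun j _ => ?_
    ring
  rw [hw, srwTwist_sum_weight Finset.univ (fun _ => 1 / (d : ℝ)) (fun j k => u k * Real.cos (k j)) hd
    (fun j _ => measurable_mul_coord hum Real.continuous_cos j)
    (fun j _ => ⟨U, abs_mul_coord_le hub abs_cos_le_one j⟩) x β, ← Finset.mul_sum,
    sum_marked i₀ _ fun j hj => srwTwist_transport₁ (n := n) u Real.cos hu hi hj x β]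

/-! ### The `D̂²` slice: two classes, or four relative to a marked coordinate -/

/-- The weight `u D̂²` as a sum over ordered pairs of coordinates. [folklore] -/
private theorem mul_Dhat_sq_eq_sum (u : (Fin d → ℝ) → ℝ) :
    (fun k : Fin d → ℝ => u k * Dhat d k ^ 2)
      = fun k => ∑ q : Fin d × Fin d, (1 / (d : ℝ)) ^ 2 * (u k * (Real.cos (k q.1) * Real.cos (k q.2))) := by
  funext k
  rw [Fintype.sum_prod_type, Dhat, div_pow, sq (∑ j, Real.cos (k j)), Finset.sum_mul_sum]
  simp only [Finset.sum_div, Finset.mul_sum]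
  refine Finset.sum_congr rfl fun j _ => Finset.sum_congr rfl fun j' _ => ?_
  ring

/-- `Tw^{u D̂²}_n = d⁻² Σ_j Σ_{j'} Tw^{u cos k_j cos k_{j'}}_n` (linearity in the weight). [folklore] -/
private theorem srwTwist_mul_Dhat_sq_eq_sum_sum {n : ℕ} (hd : 2 * n + 1 ≤ d) (u : (Fin d → ℝ) → ℝ)
    (hum : Measurable u) {U : ℝ} (hub : ∀ k, |u k| ≤ U) (x : Fin d → ℤ) (β : ℝ) :
    srwTwist d n (fun k => u k * Dhat d k ^ 2) x β
      = (1 / (d : ℝ)) ^ 2 * ∑ j, ∑ j',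
          srwTwist d n (fun k => u k * (Real.cos (k j) * Real.cos (k j'))) x β := by
  rw [mul_Dhat_sq_eq_sum u, srwTwist_sum_weight Finset.univ (fun _ => (1 / (d : ℝ)) ^ 2)
    (fun (q : Fin d × Fin d) k => u k * (Real.cos (k q.1) * Real.cos (k q.2))) hd
    (fun q _ => hum.mul ((Real.continuous_cos.measurable.comp (measurable_pi_apply q.1)).mul
      (Real.continuous_cos.measurable.comp (measurable_pi_apply q.2))))
    (fun q _ => ⟨U, fun k => by
      rw [abs_mul]
      exact (mul_le_of_le_one_right (abs_nonneg _) (abs_cos_mul_cos_le_one _ _)).trans (hub k)⟩) x β,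
    ← Finset.mul_sum, Fintype.sum_prod_type]

/-- `Tw^{u·(cos k_j · cos k_j)}_n = Tw^{u cos² k_j}_n`. [folklore] -/
private theorem srwTwist_mul_cos_mul_cos_self {n : ℕ} (u : (Fin d → ℝ) → ℝ) (j : Fin d)
    (x : Fin d → ℤ) (β : ℝ) :
    srwTwist d n (fun k => u k * (Real.cos (k j) * Real.cos (k j))) x β
      = srwTwist d n (fun k => u k * Real.cos (k j) ^ 2) x β :=
  congrArg (fun w => srwTwist d n w x β) (funext fun k => by ring)

/-- **`Tw^{u D̂²}_n = d⁻¹ Tw^{u cos² k_i}_n + ((d−1)/d) Tw^{u cos k_i cos k_{i'}}_n`** (`i ≠ i'`, `d ≥ 2n+1`) for a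
bounded measurable permutation-invariant co-factor `u`: the `d²` product seeds of the multinomial reduction of
`D̂²` form TWO classes (diagonal `j = j'`, `d` seeds; off-diagonal, `d(d−1)` seeds).
[cite: FitznerVanDerHofstad2016NoBLE, (3.34)–(3.36) p. 1071, §5.1.1 (5.2)–(5.5), (5.9) p. 1092] -/
theorem srwTwist_mul_Dhat_sq_eq_classes {n : ℕ} (hd : 2 * n + 1 ≤ d) (u : (Fin d → ℝ) → ℝ)
    (hum : Measurable u) {U : ℝ} (hub : ∀ k, |u k| ≤ U)
    (hu : ∀ (σ : Equiv.Perm (Fin d)) (k : Fin d → ℝ), u (k ∘ σ) = u k) {i i' : Fin d} (hii' : i ≠ i')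
    (x : Fin d → ℤ) (β : ℝ) :
    srwTwist d n (fun k => u k * Dhat d k ^ 2) x β
      = 1 / d * srwTwist d n (fun k => u k * Real.cos (k i) ^ 2) x β
        + ((d : ℝ) - 1) / d * srwTwist d n (fun k => u k * (Real.cos (k i) * Real.cos (k i'))) x β := by
  have hd0 : (d : ℝ) ≠ 0 := by
    have : 1 ≤ d := by omega
    positivity
  rw [srwTwist_mul_Dhat_sq_eq_sum_sum hd u hum hub x β,
    sum_sum_diag (fun j j' => srwTwist d n (fun k => u k * (Real.cos (k j) * Real.cos (k j'))) x β)
      (A := srwTwist d n (fun k => u k * Real.cos (k i) ^ 2) x β)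
      (C := srwTwist d n (fun k => u k * (Real.cos (k i) * Real.cos (k i'))) x β)
      (fun j => by
        rw [srwTwist_transport₁' (n := n) u (fun t => Real.cos t * Real.cos t) hu i j x β]
        exact srwTwist_mul_cos_mul_cos_self u i x β)
      (fun j j' hjj' => srwTwist_transport₂' (n := n) u Real.cos Real.cos hu hii' hjj' x β)]
  field_simp

/-- **`Tw^{u D̂²}_n` relative to a marked coordinate `i₀`:** for `u` invariant under the permutations fixing `i₀`
and pairwise distinct `i₀, i, i'`:
`Tw^{u D̂²}_n = d⁻² (Tw^{u cos² k_{i₀}}_n + (d−1) Tw^{u cos² k_i}_n + 2(d−1) Tw^{u cos k_{i₀} cos k_i}_n + (d−1)(d−2) Tw^{u cos k_i cos k_{i'}}_n)`.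
[cite: FitznerVanDerHofstad2016NoBLE, (3.34)–(3.36) p. 1071, §5.1.1 (5.2)–(5.5), (5.9) p. 1092] -/
theorem srwTwist_mul_Dhat_sq_eq_marked {n : ℕ} (hd : 2 * n + 1 ≤ d) (u : (Fin d → ℝ) → ℝ)
    (hum : Measurable u) {U : ℝ} (hub : ∀ k, |u k| ≤ U) {i₀ i i' : Fin d}
    (hu : ∀ σ : Equiv.Perm (Fin d), σ i₀ = i₀ → ∀ k : Fin d → ℝ, u (k ∘ σ) = u k)
    (hi : i ≠ i₀) (hi' : i' ≠ i₀) (hii' : i ≠ i') (x : Fin d → ℤ) (β : ℝ) :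
    srwTwist d n (fun k => u k * Dhat d k ^ 2) x β
      = (1 / (d : ℝ)) ^ 2 * (srwTwist d n (fun k => u k * Real.cos (k i₀) ^ 2) x β
          + ((d : ℝ) - 1) * srwTwist d n (fun k => u k * Real.cos (k i) ^ 2) x β
          + 2 * ((d : ℝ) - 1) * srwTwist d n (fun k => u k * (Real.cos (k i₀) * Real.cos (k i))) x β
          + ((d : ℝ) - 1) * ((d : ℝ) - 2)
              * srwTwist d n (fun k => u k * (Real.cos (k i) * Real.cos (k i'))) x β) := by
  -- the co-factor `u · cos k_{i₀}` is still invariant under the permutations fixing `i₀`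
  have hu₀ : ∀ σ : Equiv.Perm (Fin d), σ i₀ = i₀ → ∀ k : Fin d → ℝ,
      (fun k : Fin d → ℝ => u k * Real.cos (k i₀)) (k ∘ σ) = (fun k => u k * Real.cos (k i₀)) k := by
    intro σ hσ k
    show u (k ∘ σ) * Real.cos ((k ∘ σ) i₀) = u k * Real.cos (k i₀)
    rw [Function.comp_apply, hσ, hu σ hσ k]
  have hresh : ∀ j, srwTwist d n (fun k => u k * (Real.cos (k i₀) * Real.cos (k j))) x β
      = srwTwist d n (fun k => u k * Real.cos (k i₀) * Real.cos (k j)) x β :=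
    fun j => congrArg (fun w => srwTwist d n w x β) (funext fun k => by ring)
  have hB : ∀ j, j ≠ i₀ → srwTwist d n (fun k => u k * (Real.cos (k i₀) * Real.cos (k j))) x β
      = srwTwist d n (fun k => u k * (Real.cos (k i₀) * Real.cos (k i))) x β := by
    intro j hj
    rw [hresh j, hresh i]
    exact srwTwist_transport₁ (n := n) (fun k => u k * Real.cos (k i₀)) Real.cos hu₀ hi hj x β
  rw [srwTwist_mul_Dhat_sq_eq_sum_sum hd u hum hub x β,
    sum_sum_marked i₀ (fun j j' => srwTwist d n (fun k => u k * (Real.cos (k j) * Real.cos (k j'))) x β)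
      (A := srwTwist d n (fun k => u k * Real.cos (k i) ^ 2) x β)
      (B := srwTwist d n (fun k => u k * (Real.cos (k i₀) * Real.cos (k i))) x β)
      (C := srwTwist d n (fun k => u k * (Real.cos (k i) * Real.cos (k i'))) x β)
      (fun j hj => by
        rw [srwTwist_transport₁ (n := n) u (fun t => Real.cos t * Real.cos t) hu hi hj x β]
        exact srwTwist_mul_cos_mul_cos_self u i x β)
      hB
      (fun j hj => by
        rw [← hB j hj]
        exact congrArg (fun w => srwTwist d n w x β) (funext fun k => by ring))
      (fun j j' hj hj' hjj' => srwTwist_transport₂ (n := n) u Real.cos Real.cos hu hii' hjj' hi hi' hj hj'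
        x β),
    srwTwist_mul_cos_mul_cos_self u i₀ x β]

/-! ### The `D̂^{sin}` slice -/

/-- `|sin² t| ≤ 1`. [folklore] -/
private theorem abs_sin_sq_le_one (t : ℝ) : |Real.sin t ^ 2| ≤ 1 := by
  rw [abs_pow]; exact pow_le_one₀ (abs_nonneg _) (abs_sin_le_one t)

/-- The weight `u D̂^{sin}` as a sum over coordinates. [folklore] -/
private theorem mul_Dsin_eq_sum (u : (Fin d → ℝ) → ℝ) :
    (fun k : Fin d → ℝ => u k * Dsin d k)
      = fun k => ∑ j, (1 / (d : ℝ)) ^ 2 * (u k * Real.sin (k j) ^ 2) := by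
  funext k
  rw [Dsin, Finset.sum_div, Finset.mul_sum]
  refine Finset.sum_congr rfl fun j _ => ?_
  ring

/-- **`Tw^{u D̂^{sin}}_n = d⁻¹ Tw^{u sin² k_i}_n`** for a bounded measurable permutation-invariant co-factor `u`
(`D̂^{sin} = d⁻² Σ_j sin² k_j`, `d ≥ 2n+1`): ONE class.
[cite: FitznerVanDerHofstad2016NoBLE, §3.3.3 p. 1070, (3.34)–(3.38) p. 1071, §5.1.1 (5.2)–(5.5)] -/
theorem srwTwist_mul_Dsin_eq_class {n : ℕ} (hd : 2 * n + 1 ≤ d) (u : (Fin d → ℝ) → ℝ)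
    (hum : Measurable u) {U : ℝ} (hub : ∀ k, |u k| ≤ U)
    (hu : ∀ (σ : Equiv.Perm (Fin d)) (k : Fin d → ℝ), u (k ∘ σ) = u k) (i : Fin d)
    (x : Fin d → ℤ) (β : ℝ) :
    srwTwist d n (fun k => u k * Dsin d k) x β
      = 1 / d * srwTwist d n (fun k => u k * Real.sin (k i) ^ 2) x β := by
  have hd0 : (d : ℝ) ≠ 0 := by
    have : 1 ≤ d := by omega
    positivity
  rw [mul_Dsin_eq_sum u, srwTwist_sum_weight Finset.univ (fun _ => (1 / (d : ℝ)) ^ 2)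
    (fun j k => u k * Real.sin (k j) ^ 2) hd
    (fun j _ => measurable_mul_coord hum (Real.continuous_sin.pow 2) j)
    (fun j _ => ⟨U, abs_mul_coord_le hub abs_sin_sq_le_one j⟩) x β, ← Finset.mul_sum,
    Finset.sum_congr rfl fun j _ =>
      srwTwist_transport₁' (n := n) u (fun t => Real.sin t ^ 2) hu i j x β,
    Finset.sum_const, Finset.card_univ, Fintype.card_fin, nsmul_eq_mul]
  field_simp

/-- **`Tw^{u D̂^{sin}}_n` relative to a marked coordinate:** for `u` invariant under the permutations fixing `i₀`
and `i ≠ i₀`: `Tw^{u D̂^{sin}}_n = d⁻² (Tw^{u sin² k_{i₀}}_n + (d−1) Tw^{u sin² k_i}_n)`.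
[cite: FitznerVanDerHofstad2016NoBLE, §3.3.3 p. 1070, (3.34)–(3.38) p. 1071, §5.1.1 (5.2)–(5.5)] -/
theorem srwTwist_mul_Dsin_eq_marked {n : ℕ} (hd : 2 * n + 1 ≤ d) (u : (Fin d → ℝ) → ℝ)
    (hum : Measurable u) {U : ℝ} (hub : ∀ k, |u k| ≤ U) {i₀ i : Fin d}
    (hu : ∀ σ : Equiv.Perm (Fin d), σ i₀ = i₀ → ∀ k : Fin d → ℝ, u (k ∘ σ) = u k) (hi : i ≠ i₀)
    (x : Fin d → ℤ) (β : ℝ) :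
    srwTwist d n (fun k => u k * Dsin d k) x β
      = (1 / (d : ℝ)) ^ 2 * (srwTwist d n (fun k => u k * Real.sin (k i₀) ^ 2) x β
          + ((d : ℝ) - 1) * srwTwist d n (fun k => u k * Real.sin (k i) ^ 2) x β) := by
  rw [mul_Dsin_eq_sum u, srwTwist_sum_weight Finset.univ (fun _ => (1 / (d : ℝ)) ^ 2)
    (fun j k => u k * Real.sin (k j) ^ 2) hd
    (fun j _ => measurable_mul_coord hum (Real.continuous_sin.pow 2) j)
    (fun j _ => ⟨U, abs_mul_coord_le hub abs_sin_sq_le_one j⟩) x β, ← Finset.mul_sum,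
    sum_marked i₀ _ fun j hj =>
      srwTwist_transport₁ (n := n) u (fun t => Real.sin t ^ 2) hu hi hj x β]

/-- **`sin² = 1 − cos²` inside the twisted moment:** `Tw^{u sin² k_i}_n = Tw^{u}_n − Tw^{u cos² k_i}_n` for a bounded
measurable co-factor (`d ≥ 2n+1`). [cite: FitznerVanDerHofstad2016NoBLE, (3.34) p. 1071, §5.1.1 (5.2)–(5.5)] -/
theorem srwTwist_mul_sin_sq_eq_sub {n : ℕ} (hd : 2 * n + 1 ≤ d) (u : (Fin d → ℝ) → ℝ)
    (hum : Measurable u) {U : ℝ} (hub : ∀ k, |u k| ≤ U) (i : Fin d) (x : Fin d → ℤ) (β : ℝ) :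
    srwTwist d n (fun k => u k * Real.sin (k i) ^ 2) x β
      = srwTwist d n u x β - srwTwist d n (fun k => u k * Real.cos (k i) ^ 2) x β := by
  have hw : (fun k : Fin d → ℝ => u k * Real.sin (k i) ^ 2) = fun k => u k - u k * Real.cos (k i) ^ 2 := by
    funext k
    rw [Real.sin_sq]
    ring
  rw [hw]
  exact srwTwist_sub_weight hd u (fun k => u k * Real.cos (k i) ^ 2) hum
    (measurable_mul_coord hum (Real.continuous_cos.pow 2) i) hub
    (abs_mul_coord_le hub (fun t => by rw [abs_pow]; exact pow_le_one₀ (abs_nonneg _) (abs_cos_le_one t)) i)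
    x β

/-! ### The unit co-factor: the `K_{n,2}`, `U_{n,0}`, `U_{n,2}` weights -/

/-- **`Tw^{D̂²}_n(x;β) = d⁻¹ Tw^{cos² k_i}_n(x;β) + ((d−1)/d) Tw^{cos k_i cos k_{i'}}_n(x;β)`** (`i ≠ i'`, `d ≥ 2n+1`).
[cite: FitznerVanDerHofstad2016NoBLE, (3.34)–(3.36) p. 1071, §5.1.1 (5.2)–(5.5), (5.9) p. 1092] -/
theorem srwTwist_Dhat_sq_eq_classes {n : ℕ} (hd : 2 * n + 1 ≤ d) {i i' : Fin d} (hii' : i ≠ i')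
    (x : Fin d → ℤ) (β : ℝ) :
    srwTwist d n (fun k => Dhat d k ^ 2) x β
      = 1 / d * srwTwist d n (fun k => Real.cos (k i) ^ 2) x β
        + ((d : ℝ) - 1) / d * srwTwist d n (fun k => Real.cos (k i) * Real.cos (k i')) x β := by
  have h := srwTwist_mul_Dhat_sq_eq_classes hd (fun _ => (1 : ℝ)) measurable_const (U := 1)
    (fun _ => by rw [abs_one]) (fun _ _ => rfl) hii' x β
  simpa only [one_mul] using h

/-- **The `K_{n,2}` weight `|D̂|²` in two product classes:**
`Tw^{|D̂|²}_n(x;β) = d⁻¹ Tw^{cos² k_i}_n(x;β) + ((d−1)/d) Tw^{cos k_i cos k_{i'}}_n(x;β)` (`i ≠ i'`, `d ≥ 2n+1`).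
[cite: FitznerVanDerHofstad2016NoBLE, (3.36) p. 1071, §5.1.1 (5.2)–(5.5), (5.9) p. 1092] -/
theorem srwTwist_abs_Dhat_sq_eq_classes {n : ℕ} (hd : 2 * n + 1 ≤ d) {i i' : Fin d} (hii' : i ≠ i')
    (x : Fin d → ℤ) (β : ℝ) :
    srwTwist d n (fun k => |Dhat d k| ^ 2) x β
      = 1 / d * srwTwist d n (fun k => Real.cos (k i) ^ 2) x β
        + ((d : ℝ) - 1) / d * srwTwist d n (fun k => Real.cos (k i) * Real.cos (k i')) x β := by
  simp only [sq_abs]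
  exact srwTwist_Dhat_sq_eq_classes hd hii' x β

/-- **`Tw^{D̂^{sin}}_n(x;β) = d⁻¹ Tw^{sin² k_i}_n(x;β) = d⁻¹ (Tw^{1}_n(x;β) − Tw^{cos² k_i}_n(x;β))`** (`d ≥ 2n+1`).
[cite: FitznerVanDerHofstad2016NoBLE, §3.3.3 p. 1070, (3.38) p. 1071, §5.1.1 (5.2)–(5.5)] -/
theorem srwTwist_Dsin_eq_sub {n : ℕ} (hd : 2 * n + 1 ≤ d) (i : Fin d) (x : Fin d → ℤ) (β : ℝ) :
    srwTwist d n (Dsin d) x β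
      = 1 / d * (srwTwist d n (fun _ => (1 : ℝ)) x β - srwTwist d n (fun k => Real.cos (k i) ^ 2) x β) := by
  have h1 := srwTwist_mul_Dsin_eq_class hd (fun _ => (1 : ℝ)) measurable_const (U := 1)
    (fun _ => by rw [abs_one]) (fun _ _ => rfl) i x β
  have h2 := srwTwist_mul_sin_sq_eq_sub hd (fun _ => (1 : ℝ)) measurable_const (U := 1)
    (fun _ => by rw [abs_one]) i x β
  simp only [one_mul] at h1 h2
  rw [← h2]
  exact h1

/-- **The `U_{n,0}` weight:** `Tw^{|D̂|⁰ D̂^{sin}}_n(x;β) = d⁻¹ (Tw^{1}_n(x;β) − Tw^{cos² k_i}_n(x;β))` (`d ≥ 2n+1`).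
[cite: FitznerVanDerHofstad2016NoBLE, §3.3.3 p. 1070, (3.38) p. 1071, §5.1.1 (5.2)–(5.5), (5.9) p. 1092] -/
theorem srwTwist_abs_Dhat_pow_zero_mul_Dsin_eq {n : ℕ} (hd : 2 * n + 1 ≤ d) (i : Fin d)
    (x : Fin d → ℤ) (β : ℝ) :
    srwTwist d n (fun k => |Dhat d k| ^ 0 * Dsin d k) x β
      = 1 / d * (srwTwist d n (fun _ => (1 : ℝ)) x β - srwTwist d n (fun k => Real.cos (k i) ^ 2) x β) := by
  simp only [pow_zero, one_mul]
  exact srwTwist_Dsin_eq_sub hd i x β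

/-- **The `U_{n,2}` weight in four `sin² k_{i₀}`-marked product classes:** for pairwise distinct `i₀, i, i'`
(`d ≥ 2n+1`), `Tw^{|D̂|² D̂^{sin}}_n = d⁻¹ · d⁻² (Tw^{sin² k_{i₀} cos² k_{i₀}}_n + (d−1) Tw^{sin² k_{i₀} cos² k_i}_n
 + 2(d−1) Tw^{sin² k_{i₀} cos k_{i₀} cos k_i}_n + (d−1)(d−2) Tw^{sin² k_{i₀} cos k_i cos k_{i'}}_n)`.
[cite: FitznerVanDerHofstad2016NoBLE, §3.3.3 p. 1070, (3.38) p. 1071, §5.1.1 (5.2)–(5.5), (5.9) p. 1092] -/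
theorem srwTwist_abs_Dhat_sq_mul_Dsin_eq_marked {n : ℕ} (hd : 2 * n + 1 ≤ d) {i₀ i i' : Fin d}
    (hi : i ≠ i₀) (hi' : i' ≠ i₀) (hii' : i ≠ i') (x : Fin d → ℤ) (β : ℝ) :
    srwTwist d n (fun k => |Dhat d k| ^ 2 * Dsin d k) x β
      = 1 / d * ((1 / (d : ℝ)) ^ 2
          * (srwTwist d n (fun k => Real.sin (k i₀) ^ 2 * Real.cos (k i₀) ^ 2) x β
            + ((d : ℝ) - 1) * srwTwist d n (fun k => Real.sin (k i₀) ^ 2 * Real.cos (k i) ^ 2) x β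
            + 2 * ((d : ℝ) - 1)
                * srwTwist d n (fun k => Real.sin (k i₀) ^ 2 * (Real.cos (k i₀) * Real.cos (k i))) x β
            + ((d : ℝ) - 1) * ((d : ℝ) - 2)
                * srwTwist d n (fun k => Real.sin (k i₀) ^ 2 * (Real.cos (k i) * Real.cos (k i'))) x β)) := by
  -- `|D̂|² D̂^{sin} = D̂² · D̂^{sin}` with the permutation-invariant co-factor `D̂²`
  have hD : ∀ (σ : Equiv.Perm (Fin d)) (k : Fin d → ℝ),
      (fun k : Fin d → ℝ => Dhat d k ^ 2) (k ∘ σ) = (fun k => Dhat d k ^ 2) k := by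
    intro σ k
    show Dhat d (k ∘ σ) ^ 2 = Dhat d k ^ 2
    rw [Dhat_comp_perm]
  have hDm : Measurable fun k : Fin d → ℝ => Dhat d k ^ 2 := (continuous_Dhat d).measurable.pow_const 2
  have hDb : ∀ k : Fin d → ℝ, |Dhat d k ^ 2| ≤ 1 := fun k => by
    rw [← sq_abs, abs_pow, abs_abs]; exact abs_Dhat_pow_le_one 2 k
  have h1 := srwTwist_mul_Dsin_eq_class hd (fun k => Dhat d k ^ 2) hDm hDb hD i₀ x β
  -- the marked co-factor `sin² k_{i₀}`
  have hS : ∀ σ : Equiv.Perm (Fin d), σ i₀ = i₀ → ∀ k : Fin d → ℝ,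
      (fun k : Fin d → ℝ => Real.sin (k i₀) ^ 2) (k ∘ σ) = (fun k => Real.sin (k i₀) ^ 2) k := by
    intro σ hσ k
    show Real.sin ((k ∘ σ) i₀) ^ 2 = Real.sin (k i₀) ^ 2
    rw [Function.comp_apply, hσ]
  have hSm : Measurable fun k : Fin d → ℝ => Real.sin (k i₀) ^ 2 :=
    (Real.continuous_sin.measurable.comp (measurable_pi_apply i₀)).pow_const 2
  have h2 := srwTwist_mul_Dhat_sq_eq_marked hd (fun k => Real.sin (k i₀) ^ 2) hSm (U := 1)
    (fun k => abs_sin_sq_le_one (k i₀)) hS hi hi' hii' x β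
  have hswap : srwTwist d n (fun k => Dhat d k ^ 2 * Real.sin (k i₀) ^ 2) x β
      = srwTwist d n (fun k => Real.sin (k i₀) ^ 2 * Dhat d k ^ 2) x β :=
    congrArg (fun w => srwTwist d n w x β) (funext fun k => mul_comm _ _)
  simp only [sq_abs]
  rw [h1, hswap, h2]

/-! ### The `KM₂` weight `M̂²` (`l = 0`): `D̂²`, `D̂ D̂^{sin}`, `(D̂^{sin})²` in classes -/

/-- `D̂^{sin}(k ∘ σ) = D̂^{sin}(k)`. [cite: FitznerVanDerHofstad2016NoBLE, §3.3.3 p. 1070] -/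
theorem Dsin_comp_perm (σ : Equiv.Perm (Fin d)) (k : Fin d → ℝ) : Dsin d (k ∘ σ) = Dsin d k := by
  simp only [Dsin, Function.comp_apply]
  rw [Equiv.sum_comp σ (fun j => Real.sin (k j) ^ 2)]

/-- `|D̂^{sin}| ≤ 1` (`d ≥ 1`). [folklore] -/
private theorem abs_Dsin_le_one (hd : 1 ≤ d) (k : Fin d → ℝ) : |Dsin d k| ≤ 1 := by
  rw [abs_of_nonneg (Dsin_nonneg k)]
  have h1 : (1 : ℝ) ≤ d := by exact_mod_cast hd
  exact (Dsin_le_inv hd k).trans (by rw [one_div]; exact inv_le_one_of_one_le₀ h1)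

/-- **`Tw^{D̂ D̂^{sin}}_n = d⁻² (Tw^{cos k_i sin² k_i}_n + (d−1) Tw^{cos k_i sin² k_{i'}}_n)`** (`i ≠ i'`, `d ≥ 2n+1`):
the `d²` seeds `cos k_j sin² k_s` form two classes (`j = s`, `j ≠ s`).
[cite: FitznerVanDerHofstad2016NoBLE, §3.3.3 p. 1070, (3.34)–(3.37) p. 1071, §5.2 (5.9), (5.14) p. 1092] -/
theorem srwTwist_Dhat_mul_Dsin_eq_classes {n : ℕ} (hd : 2 * n + 1 ≤ d) {i i' : Fin d} (hii' : i ≠ i')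
    (x : Fin d → ℤ) (β : ℝ) :
    srwTwist d n (fun k => Dhat d k * Dsin d k) x β
      = (1 / (d : ℝ)) ^ 2 * (srwTwist d n (fun k => Real.cos (k i) * Real.sin (k i) ^ 2) x β
          + ((d : ℝ) - 1) * srwTwist d n (fun k => Real.cos (k i) * Real.sin (k i') ^ 2) x β) := by
  have hd1 : 1 ≤ d := by omega
  -- `D̂ D̂^{sin} = D̂^{sin} · D̂`, co-factor `D̂^{sin}` permutation invariant: one class `D̂^{sin} cos k_i`
  have h1 := srwTwist_mul_Dhat_eq_class hd (Dsin d) (continuous_Dsin d).measurable (abs_Dsin_le_one hd1)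
    (fun σ k => Dsin_comp_perm σ k) i x β
  -- `D̂^{sin} cos k_i = cos k_i · D̂^{sin}`, co-factor `cos k_i` invariant under the permutations fixing `i`
  have hc : ∀ σ : Equiv.Perm (Fin d), σ i = i → ∀ k : Fin d → ℝ,
      (fun k : Fin d → ℝ => Real.cos (k i)) (k ∘ σ) = (fun k => Real.cos (k i)) k := by
    intro σ hσ k
    show Real.cos ((k ∘ σ) i) = Real.cos (k i)
    rw [Function.comp_apply, hσ]
  have h2 := srwTwist_mul_Dsin_eq_marked hd (fun k => Real.cos (k i))
    (Real.continuous_cos.measurable.comp (measurable_pi_apply i)) (U := 1) (fun _ => abs_cos_le_one _)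
    hc hii'.symm x β
  have e0 : srwTwist d n (fun k => Dhat d k * Dsin d k) x β = srwTwist d n (fun k => Dsin d k * Dhat d k) x β :=
    congrArg (fun w => srwTwist d n w x β) (funext fun k => mul_comm _ _)
  have e1 : srwTwist d n (fun k => Dsin d k * Real.cos (k i)) x β
      = srwTwist d n (fun k => Real.cos (k i) * Dsin d k) x β :=
    congrArg (fun w => srwTwist d n w x β) (funext fun k => mul_comm _ _)
  rw [e0, h1, e1, h2]

/-- **`Tw^{(D̂^{sin})²}_n = d⁻³ (Tw^{sin⁴ k_i}_n + (d−1) Tw^{sin² k_i sin² k_{i'}}_n)`** (`i ≠ i'`, `d ≥ 2n+1`).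
[cite: FitznerVanDerHofstad2016NoBLE, §3.3.3 p. 1070, (3.34)–(3.37) p. 1071, §5.2 (5.9), (5.14) p. 1092] -/
theorem srwTwist_Dsin_sq_eq_classes {n : ℕ} (hd : 2 * n + 1 ≤ d) {i i' : Fin d} (hii' : i ≠ i')
    (x : Fin d → ℤ) (β : ℝ) :
    srwTwist d n (fun k => Dsin d k ^ 2) x β
      = (1 / (d : ℝ)) ^ 3 * (srwTwist d n (fun k => Real.sin (k i) ^ 4) x β
          + ((d : ℝ) - 1) * srwTwist d n (fun k => Real.sin (k i) ^ 2 * Real.sin (k i') ^ 2) x β) := by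
  have hd1 : 1 ≤ d := by omega
  have h1 := srwTwist_mul_Dsin_eq_class hd (Dsin d) (continuous_Dsin d).measurable (abs_Dsin_le_one hd1)
    (fun σ k => Dsin_comp_perm σ k) i x β
  have hs : ∀ σ : Equiv.Perm (Fin d), σ i = i → ∀ k : Fin d → ℝ,
      (fun k : Fin d → ℝ => Real.sin (k i) ^ 2) (k ∘ σ) = (fun k => Real.sin (k i) ^ 2) k := by
    intro σ hσ k
    show Real.sin ((k ∘ σ) i) ^ 2 = Real.sin (k i) ^ 2
    rw [Function.comp_apply, hσ]
  have h2 := srwTwist_mul_Dsin_eq_marked hd (fun k => Real.sin (k i) ^ 2)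
    ((Real.continuous_sin.measurable.comp (measurable_pi_apply i)).pow_const 2) (U := 1)
    (fun _ => abs_sin_sq_le_one _) hs hii'.symm x β
  have e0 : srwTwist d n (fun k => Dsin d k ^ 2) x β = srwTwist d n (fun k => Dsin d k * Dsin d k) x β :=
    congrArg (fun w => srwTwist d n w x β) (funext fun k => sq _)
  have e1 : srwTwist d n (fun k => Dsin d k * Real.sin (k i) ^ 2) x β
      = srwTwist d n (fun k => Real.sin (k i) ^ 2 * Dsin d k) x β :=
    congrArg (fun w => srwTwist d n w x β) (funext fun k => mul_comm _ _)
  have e2 : srwTwist d n (fun k => Real.sin (k i) ^ 2 * Real.sin (k i) ^ 2) x β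
      = srwTwist d n (fun k => Real.sin (k i) ^ 4) x β :=
    congrArg (fun w => srwTwist d n w x β) (funext fun k => by ring)
  rw [e0, h1, e1, h2, e2]
  ring

/-- **The `KM₂` weight `M̂²` in product classes** (`i ≠ i'`, `d ≥ 2n+5`; `M̂ = D̂ − 2D̂^{sin}Ĉ`, a factor `Ĉ`
shifts the Schwinger order): `Tw^{|D̂|⁰ M̂²}_n = (d⁻¹ Tw^{cos² k_i}_n + ((d−1)/d) Tw^{cos k_i cos k_{i'}}_n)
 − 4 d⁻² (Tw^{cos k_i sin² k_i}_{n+1} + (d−1) Tw^{cos k_i sin² k_{i'}}_{n+1}) + 4 d⁻³ (Tw^{sin⁴ k_i}_{n+2} + (d−1) Tw^{sin² k_i sin² k_{i'}}_{n+2})`.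
[cite: FitznerVanDerHofstad2016NoBLE, §3.3.3 p. 1070, (3.34)–(3.37) p. 1071, §5.2 (5.9), (5.14) p. 1092] -/
theorem srwTwist_abs_Dhat_pow_zero_mul_Mhat_sq_eq_classes {n : ℕ} (hd : 2 * (n + 2) + 1 ≤ d)
    {i i' : Fin d} (hii' : i ≠ i') (x : Fin d → ℤ) (β : ℝ) :
    srwTwist d n (fun k => |Dhat d k| ^ 0 * Mhat d k ^ 2) x β
      = (1 / d * srwTwist d n (fun k => Real.cos (k i) ^ 2) x β
          + ((d : ℝ) - 1) / d * srwTwist d n (fun k => Real.cos (k i) * Real.cos (k i')) x β)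
        - 4 * ((1 / (d : ℝ)) ^ 2 * (srwTwist d (n + 1) (fun k => Real.cos (k i) * Real.sin (k i) ^ 2) x β
          + ((d : ℝ) - 1) * srwTwist d (n + 1) (fun k => Real.cos (k i) * Real.sin (k i') ^ 2) x β))
        + 4 * ((1 / (d : ℝ)) ^ 3 * (srwTwist d (n + 2) (fun k => Real.sin (k i) ^ 4) x β
          + ((d : ℝ) - 1) * srwTwist d (n + 2) (fun k => Real.sin (k i) ^ 2 * Real.sin (k i') ^ 2) x β)) := by
  have h := srwTwist_abs_Dhat_pow_mul_Mhat_sq_eq_of_even hd x β (l := 0) ⟨0, rfl⟩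
  simp only [zero_add, pow_one, pow_zero, one_mul] at h
  simp only [pow_zero, one_mul]
  rw [h, srwTwist_Dhat_sq_eq_classes (by omega) hii' x β,
    srwTwist_Dhat_mul_Dsin_eq_classes (by omega) hii' x β, srwTwist_Dsin_sq_eq_classes (by omega) hii' x β]

/-- **Pure products, I:** `Tw^{cos k_i sin² k_j}_n = Tw^{cos k_i}_n − Tw^{cos k_i cos² k_j}_n` (any `i, j`; `d ≥ 2n+1`).
[cite: FitznerVanDerHofstad2016NoBLE, (3.34) p. 1071, §5.1.1 (5.2)–(5.5)] -/
theorem srwTwist_cos_mul_sin_sq_eq_sub {n : ℕ} (hd : 2 * n + 1 ≤ d) (i j : Fin d) (x : Fin d → ℤ)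
    (β : ℝ) :
    srwTwist d n (fun k => Real.cos (k i) * Real.sin (k j) ^ 2) x β
      = srwTwist d n (fun k => Real.cos (k i)) x β
        - srwTwist d n (fun k => Real.cos (k i) * Real.cos (k j) ^ 2) x β :=
  srwTwist_mul_sin_sq_eq_sub hd (fun k => Real.cos (k i))
    (Real.continuous_cos.measurable.comp (measurable_pi_apply i)) (U := 1) (fun _ => abs_cos_le_one _)
    j x β

/-- **Pure products, II:** `Tw^{sin² k_i sin² k_j}_n = (Tw^{1}_n − Tw^{cos² k_i}_n) − (Tw^{cos² k_j}_n − Tw^{cos² k_j cos² k_i}_n)`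
(any `i, j` — for `i = j` the left side is `Tw^{sin⁴ k_i}_n`; `d ≥ 2n+1`).
[cite: FitznerVanDerHofstad2016NoBLE, (3.34) p. 1071, §5.1.1 (5.2)–(5.5)] -/
theorem srwTwist_sin_sq_mul_sin_sq_eq {n : ℕ} (hd : 2 * n + 1 ≤ d) (i j : Fin d) (x : Fin d → ℤ)
    (β : ℝ) :
    srwTwist d n (fun k => Real.sin (k i) ^ 2 * Real.sin (k j) ^ 2) x β
      = (srwTwist d n (fun _ => (1 : ℝ)) x β - srwTwist d n (fun k => Real.cos (k i) ^ 2) x β)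
        - (srwTwist d n (fun k => Real.cos (k j) ^ 2) x β
            - srwTwist d n (fun k => Real.cos (k j) ^ 2 * Real.cos (k i) ^ 2) x β) := by
  have hSm : Measurable fun k : Fin d → ℝ => Real.sin (k i) ^ 2 :=
    (Real.continuous_sin.measurable.comp (measurable_pi_apply i)).pow_const 2
  have hCm : Measurable fun k : Fin d → ℝ => Real.cos (k j) ^ 2 :=
    (Real.continuous_cos.measurable.comp (measurable_pi_apply j)).pow_const 2
  have hCb : ∀ k : Fin d → ℝ, |Real.cos (k j) ^ 2| ≤ 1 := fun k => by
    rw [abs_pow]; exact pow_le_one₀ (abs_nonneg _) (abs_cos_le_one _)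
  have h1 := srwTwist_mul_sin_sq_eq_sub hd (fun k => Real.sin (k i) ^ 2) hSm (U := 1)
    (fun _ => abs_sin_sq_le_one _) j x β
  have h2 := srwTwist_mul_sin_sq_eq_sub hd (fun _ => (1 : ℝ)) measurable_const (U := 1)
    (fun _ => by rw [abs_one]) i x β
  have h3 := srwTwist_mul_sin_sq_eq_sub hd (fun k => Real.cos (k j) ^ 2) hCm hCb i x β
  simp only [one_mul] at h2
  have e1 : srwTwist d n (fun k => Real.sin (k i) ^ 2 * Real.cos (k j) ^ 2) x β
      = srwTwist d n (fun k => Real.cos (k j) ^ 2 * Real.sin (k i) ^ 2) x β :=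
    congrArg (fun w => srwTwist d n w x β) (funext fun k => mul_comm _ _)
  rw [h1, h2, e1, h3]

/-- `Tw^{sin⁴ k_i}_n = Tw^{sin² k_i sin² k_i}_n` (to read `srwTwist_sin_sq_mul_sin_sq_eq` at `i = j`).
[cite: FitznerVanDerHofstad2016NoBLE, (3.34) p. 1071] -/
theorem srwTwist_sin_pow_four_eq (n : ℕ) (i : Fin d) (x : Fin d → ℤ) (β : ℝ) :
    srwTwist d n (fun k => Real.sin (k i) ^ 4) x β
      = srwTwist d n (fun k => Real.sin (k i) ^ 2 * Real.sin (k i) ^ 2) x β :=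
  congrArg (fun w => srwTwist d n w x β) (funext fun k => by ring)

/-! ### Bridges from the exponent-vector form of the product kernels -/

/-- `Π_μ cos(k_μ)^{(a·e_i)_μ} = cos(k_i)^a`. [folklore]
[cite: FitznerVanDerHofstad2016NoBLE, (3.34) p. 1071, §5.1.1 (5.2)–(5.5)] -/
theorem prod_cos_pow_single (i : Fin d) (a : ℕ) (k : Fin d → ℝ) :
    ∏ μ, Real.cos (k μ) ^ (Pi.single i a : Fin d → ℕ) μ = Real.cos (k i) ^ a := by
  rw [Finset.prod_eq_single i (fun μ _ hμ => by rw [Pi.single_eq_of_ne hμ, pow_zero])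
    (fun h => absurd (Finset.mem_univ i) h), Pi.single_eq_same]

/-- `Π_μ cos(k_μ)^{(a·e_i + b·e_{i'})_μ} = cos(k_i)^a cos(k_{i'})^b`. [folklore]
[cite: FitznerVanDerHofstad2016NoBLE, (3.34) p. 1071, §5.1.1 (5.2)–(5.5)] -/
theorem prod_cos_pow_single_add_single (i i' : Fin d) (a b : ℕ) (k : Fin d → ℝ) :
    ∏ μ, Real.cos (k μ) ^ (Pi.single i a + Pi.single i' b : Fin d → ℕ) μ
      = Real.cos (k i) ^ a * Real.cos (k i') ^ b := by
  simp only [Pi.add_apply, pow_add, Finset.prod_mul_distrib, prod_cos_pow_single]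

/-- The product cosine-power twisted seed with exponent vector `a·e_i` is `Tw^{cos^a k_i}_n`.
[cite: FitznerVanDerHofstad2016NoBLE, (3.34)–(3.36) p. 1071, §5.1.1 (5.2)–(5.5)] -/
theorem srwTwist_prodCosPow_single (n : ℕ) (i : Fin d) (a : ℕ) (x : Fin d → ℤ) (β : ℝ) :
    srwTwist d n (fun k => ∏ μ, Real.cos (k μ) ^ (Pi.single i a : Fin d → ℕ) μ) x β
      = srwTwist d n (fun k => Real.cos (k i) ^ a) x β := by
  simp only [prod_cos_pow_single]

/-- The product cosine-power twisted seed with exponent vector `a·e_i + b·e_{i'}` is `Tw^{cos^a k_i cos^b k_{i'}}_n`.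
[cite: FitznerVanDerHofstad2016NoBLE, (3.34)–(3.36) p. 1071, §5.1.1 (5.2)–(5.5)] -/
theorem srwTwist_prodCosPow_single_add_single (n : ℕ) (i i' : Fin d) (a b : ℕ) (x : Fin d → ℤ)
    (β : ℝ) :
    srwTwist d n (fun k => ∏ μ, Real.cos (k μ) ^ (Pi.single i a + Pi.single i' b : Fin d → ℕ) μ) x β
      = srwTwist d n (fun k => Real.cos (k i) ^ a * Real.cos (k i') ^ b) x β := by
  simp only [prod_cos_pow_single_add_single]

end Literature.Probability.FitznerVanDerHofstad2017

end
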